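import Literature.NumberTheory.EllipticCurves.QuadraticTwistKroneckerRootNumberProofs
import Literature.NumberTheory.EllipticCurves.BSDHeegnerPointsGrossZagierProofs
import Literature.NumberTheory.EllipticCurves.RootNumberSmulProofs
import Literature.NumberTheory.EllipticCurves.LFunctionSmulProofs
import HarnessLib

/-!
# Cell «bsd-uniform», track U2 (2-adic assembly), ROUTE B — the assembly:
# rank dichotomy of the `a_q`-odd genus pair `(E^{(d)}, E^{(d·D)})` from root numbers, parity,
# and ONE analytic input `L'(1, E, χ) ≠ 0`

HONEST FRAMING (cell «bsd-uniform», HOME `run/shared/lean/pub/bsd-uniform/`, seat u2-p2, route B =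
"parity / root-number bookkeeping at `2` first, then the combination"). What this file IS: a PROVED
reduction, in the tree's own currency (`rootNumber`, `analyticRank`, `entireLFunction`,
`quadraticTwist`, Miller/GZK named facts as binders), of the RANK statement of the «a_q-odd transport
at 2» (route T4′ of sub-lane «bsd-p2», `p2/idea-2/T4-PROOF.md` §4 Theorem A/A′; printed neighbour
Kriz–Li 2019 Thm. 3.3 = FMS Thm. 4.3, whose conclusion shape `KrizLi2019.thm33_rank_twist` is
reproduced literally) to a SINGLE analytic hypothesis

  `hGZ : deriv (s ↦ L(E^{(d)}, s) · L(E^{(d·D)}, s)) 1 ≠ 0`, i.e. `L'(1, E, χ) ≠ 0`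

for the ring class character `χ = χ_{M*}` of `K = ℚ(√D)` cut out by `K(√d)` (`d = M*`,
`L(s, E, χ) = L(E^{(d)}, s) L(E^{(dD)}, s)`). That hypothesis is exactly what the genus-point
combination (layer 2, sibling file `GenusPointCombination`: `P(χ)` is not torsion, from
Gross 1991 Prop. 3.7 / Darmon 2004 Prop. 3.10 / `E(H_M)[2] = 0` / `y_K ∉ 2E(K)`) feeds into the
explicit Gross–Zagier formula for ring class characters (Cai–Shu–Tian 2014 Thm. 1.1, typed in the
tree as `CaiShuTian2014.thm11_ringClassChar`; `ĥ(P(χ)) > 0 ⇒ L'(1, E, χ) ≠ 0`). Everything between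
`hGZ` and the rank table is PROVED here: root numbers of the pair (Murty–Murty; the tree's
`rootNumber_quadraticTwist_of_emod_four_eq_one`, conditional on Modularity `exists_isNewformOf`),
parity of the analytic rank (`even_analyticRank_iff`, a binder: Silverman AEC C.16.3, discharged in
the tree from Modularity by `even_analyticRank_iff_of`), orders of vanishing add
(`analyticOrderNatAt_mul`), a zero of order `≥ 1` with non-zero derivative is simple, and
Gross–Zagier–Kolyvagin over `ℚ` (`rank_eq_analyticRank_of_analyticRank_le_one`, binder) for the
Mordell–Weil ranks. What this file is NOT: it does not prove `hGZ`, asserts nothing about Heegner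
points, proves no case of BSD and moves no residual-map mark. NO Selmer group, NO local condition at
`2` and NO reduction-type hypothesis enters the RANK layer — the reduction types at `2` enter only the
`Ш[2]`/BSD(2) layer (T4-PROOF L4/B′: `c_2(E)` odd via Kramer–Tunnell §6; residue = `c_2` even,
HOME/RESIDUE.md).

## Contents (theorems only; no `def`, no named fact introduced)

* `analyticOrderNatAt_mul_entireLFunction`: `ord_{s=1} L(V₁,s)L(V₂,s) = r_an(V₁) + r_an(V₂)`.
* `odd_add_of_rootNumber_mul_eq_neg_one`: `w₁ w₂ = −1` + parity ⇒ `r_an(V₁) + r_an(V₂)` odd.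
* `rootNumber_twist_mul_rootNumber_pairTwist`: `w(E^{(d)}) w(E^{(dD)}) = J(−1 | |D|) J(N | |D|)`
  (`= χ_D(−N)`, `= −1` under the Heegner hypothesis for odd `D`: sibling file `GenusTwistSignLaw` §2).
* `rank_eq_iff_rootNumber_mul_eq_one`: the parity bookkeeping `r₁ = r ↔ w₁ w = 1` (`r, r₁ ≤ 1`).
* **`analyticRank_genusPair_dichotomy`** (END, route B): under `hGZ`, `{r_an(E^{(d)}), r_an(E^{(dD)})}
  = {0, 1}` and `r_an(E^{(d)}) = r_an(E) ↔ χ_d(−N) = sign d · J(N | |d|) = 1`.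
* `rank_genusPair_dichotomy_of_models`: the same on arbitrary (e.g. globally minimal) models
  `C • Wᵢ = W.quadraticTwist _`, with `rank = r_an` and `Ш` finite for both (GZK), i.e. LITERALLY
  the conclusion of `KrizLi2019.thm33_rank_twist` — for inert AND split `a_q`-odd primes alike,
  with (★) replaced by `hGZ`.

References: Kriz–Li, FMS 7 (2019) e15 = arXiv:1606.03172, Thm. 3.3/4.3 [KrizLi2019]; Murty–Murty
1997 Ch. 6 §1 [MurtyMurty1997]; Silverman AEC C.16 [SilvermanAEC2009]; Darmon 2004 Thm. 3.22, §3.6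
[Darmon2004]; Cai–Shu–Tian 2014 Thm. 1.1 [CaiShuTian2014]; Gross 1991 Prop. 3.7 [GrossLMS1991];
`p2/idea-2/T4-PROOF.md` v1.9b §4 (EVIDENCE write-up of route T4′).
-/

noncomputable section

open scoped Classical NumberTheorySymbols

open WeierstrassCurve Literature.NumberTheory.EllipticCurves
  Literature.NumberTheory.EllipticCurves.ModularForms

namespace Summit.BirchSwinnertonDyer.Uniform.U2

variable (W : WeierstrassCurve ℚ) [W.IsElliptic]

/-- `(−1 / |d|) = sign d` for `d ≡ 1 (mod 4)` (private copy of the sibling file's lemma). [folklore] -/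
private theorem jacobiSym_neg_one_natAbs_eq_sign' {d : ℤ} (hd4 : d % 4 = 1) :
    J(-1 | d.natAbs) = Int.sign d := by
  have hd0 : d ≠ 0 := by rintro rfl; norm_num at hd4
  have hodd : Odd d.natAbs := Int.natAbs_odd.2 (Int.odd_iff.2 (by omega))
  rw [jacobiSym.at_neg_one hodd]
  rcases lt_or_gt_of_ne hd0 with h | h
  · rw [Int.sign_eq_neg_one_of_neg h]
    exact ZMod.χ₄_nat_three_mod_four (by omega)
  · rw [Int.sign_eq_one_of_pos h]
    exact ZMod.χ₄_nat_one_mod_four (by omega)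

/-- **Orders of vanishing add**: for elliptic `V₁, V₂ / ℚ` with entire `L`-functions,
`ord_{s=1} (L(V₁, s) · L(V₂, s)) = r_an(V₁) + r_an(V₂)` (both continuations analytic at `1` and not
identically zero there; Mathlib `analyticOrderNatAt_mul`). The tree's
`analyticRankEK_eq_add_of_hasEntireLFunction` is the case `V₂ = V₁^{(d_K)}`. [cite: Darmon2004, §3.6 (3.12)] -/
theorem analyticOrderNatAt_mul_entireLFunction (V₁ V₂ : WeierstrassCurve ℚ) [V₁.IsElliptic]
    [V₂.IsElliptic] (h₁ : V₁.HasEntireLFunction) (h₂ : V₂.HasEntireLFunction) :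
    analyticOrderNatAt (fun s => V₁.entireLFunction s * V₂.entireLFunction s) 1 =
      V₁.analyticRank + V₂.analyticRank := by
  have hf : AnalyticAt ℂ V₁.entireLFunction 1 := (V₁.differentiable_entireLFunction h₁).analyticAt 1
  have hg : AnalyticAt ℂ V₂.entireLFunction 1 := (V₂.differentiable_entireLFunction h₂).analyticAt 1
  show analyticOrderNatAt (V₁.entireLFunction * V₂.entireLFunction) 1 = _
  exact analyticOrderNatAt_mul hf hg (V₁.analyticOrderAt_entireLFunction_ne_top h₁)
    (V₂.analyticOrderAt_entireLFunction_ne_top h₂)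

/-- **Opposite signs force an odd total order of vanishing**: if `Even r_an(Vᵢ) ↔ w(Vᵢ) = 1`
(`i = 1, 2`) and `w(V₁) w(V₂) = −1`, then `r_an(V₁) + r_an(V₂)` is odd (the tree's
`odd_analyticRankEK_of_rootNumber`, unbundled from the pair `(W, W^{(d_K)})`).
[cite: Darmon2004, §3.6, Thm. 3.15 and (3.16)–(3.17)] -/
theorem odd_add_of_rootNumber_mul_eq_neg_one (V₁ V₂ : WeierstrassCurve ℚ) [V₁.IsElliptic]
    [V₂.IsElliptic] (hpar₁ : Even V₁.analyticRank ↔ V₁.rootNumber = 1)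
    (hpar₂ : Even V₂.analyticRank ↔ V₂.rootNumber = 1)
    (hsign : V₁.rootNumber * V₂.rootNumber = -1) :
    Odd (V₁.analyticRank + V₂.analyticRank) := by
  rcases V₁.rootNumber_eq_one_or with hw | hw
  · have hw' : V₂.rootNumber = -1 := by rw [hw, one_mul] at hsign; exact hsign
    have hr : Even V₁.analyticRank := hpar₁.mpr hw
    have hr' : Odd V₂.analyticRank := by
      rcases Nat.even_or_odd V₂.analyticRank with h | h
      · exact absurd ((hpar₂.mp h).symm.trans hw') (by decide)
      · exact h
    exact hr.add_odd hr'
  · have hw' : V₂.rootNumber = 1 := by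
      rw [hw, neg_one_mul, neg_inj] at hsign; exact hsign
    have hr' : Even V₂.analyticRank := hpar₂.mpr hw'
    have hr : Odd V₁.analyticRank := by
      rcases Nat.even_or_odd V₁.analyticRank with h | h
      · exact absurd ((hpar₁.mp h).symm.trans hw) (by decide)
      · exact h
    exact hr.add_even hr'

/-- **Product of the root numbers of the genus pair.** For `d ≡ D ≡ 1 (mod 4)` with `dD` squarefree
and prime to `N = N_E`: `w(E^{(d)}) · w(E^{(dD)}) = J(−1 | |D|) · J(N | |D|) (= χ_D(−N) = w(E) w(E^{(D)}))`,
from `w(E^{(e)}) = J(−1 | |e|) J(N | |e|) w(E)` (the tree's `rootNumber_quadraticTwist_of_emod_four_eq_one`,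
Murty–Murty 1997 Ch. 6 §1, conditional on Modularity `hmod`) at `e = d` and `e = dD`,
multiplicativity of the Jacobi symbol in the lower argument and `J(· | |d|)² = w(E)² = 1`.
[cite: MurtyMurty1997, Ch. 6 §1 (functional equation of L_D(s, f))] -/
theorem rootNumber_twist_mul_rootNumber_pairTwist (hmod : exists_isNewformOf) {d D : ℤ}
    (hd4 : d % 4 = 1) (hD4 : D % 4 = 1) (hsq : Squarefree (d * D))
    (hgcd : Int.gcd (d * D) (W.conductorNorm ℤ) = 1) :
    (W.quadraticTwist (d : ℚ)).rootNumber * (W.quadraticTwist ((d * D : ℤ) : ℚ)).rootNumber =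
      J(-1 | D.natAbs) * J((W.conductorNorm ℤ : ℤ) | D.natAbs) := by
  have hd0 : d ≠ 0 := by rintro rfl; norm_num at hd4
  have hD0 : D ≠ 0 := by rintro rfl; norm_num at hD4
  have hsqd : Squarefree d := Squarefree.of_mul_left hsq
  have hdD4 : (d * D) % 4 = 1 := by
    have : (d * D) % 4 = ((d % 4) * (D % 4)) % 4 := Int.mul_emod d D 4
    rw [this, hd4, hD4]; norm_num
  have hcop : IsCoprime (d * D) (W.conductorNorm ℤ : ℤ) := Int.isCoprime_iff_gcd_eq_one.2 hgcd
  have hgcdd : Int.gcd d (W.conductorNorm ℤ) = 1 :=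
    Int.isCoprime_iff_gcd_eq_one.1 hcop.of_mul_left_left
  obtain ⟨h1, -⟩ := W.rootNumber_quadraticTwist_of_emod_four_eq_one hmod hd4 hsqd hgcdd
  obtain ⟨h2, -⟩ := W.rootNumber_quadraticTwist_of_emod_four_eq_one hmod hdD4 hsq hgcd
  rw [h1, h2]
  haveI : NeZero d.natAbs := ⟨Int.natAbs_ne_zero.2 hd0⟩
  haveI : NeZero D.natAbs := ⟨Int.natAbs_ne_zero.2 hD0⟩
  rw [Int.natAbs_mul, jacobiSym.mul_right, jacobiSym.mul_right]
  have hw : W.rootNumber * W.rootNumber = 1 := by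
    rcases W.rootNumber_eq_one_or with h | h <;> rw [h] <;> norm_num
  have hm1 : J(-1 | d.natAbs) * J(-1 | d.natAbs) = 1 := by
    have := jacobiSym.sq_one (a := -1) (b := d.natAbs) (by simp [Int.gcd])
    rwa [sq] at this
  have hN : J((W.conductorNorm ℤ : ℤ) | d.natAbs) * J((W.conductorNorm ℤ : ℤ) | d.natAbs) = 1 := by
    have hg : Int.gcd (W.conductorNorm ℤ : ℤ) d.natAbs = 1 := by
      rw [Int.gcd_comm] at hgcdd
      simpa [Int.gcd, Int.natAbs_abs] using hgcdd
    have := jacobiSym.sq_one hg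
    rwa [sq] at this
  calc J(-1 | d.natAbs) * J((W.conductorNorm ℤ : ℤ) | d.natAbs) * W.rootNumber *
        (J(-1 | d.natAbs) * J(-1 | D.natAbs) *
          (J((W.conductorNorm ℤ : ℤ) | d.natAbs) * J((W.conductorNorm ℤ : ℤ) | D.natAbs)) *
            W.rootNumber)
      = (J(-1 | d.natAbs) * J(-1 | d.natAbs)) *
          (J((W.conductorNorm ℤ : ℤ) | d.natAbs) * J((W.conductorNorm ℤ : ℤ) | d.natAbs)) *
          (W.rootNumber * W.rootNumber) *
          (J(-1 | D.natAbs) * J((W.conductorNorm ℤ : ℤ) | D.natAbs)) := by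
        ring
    _ = J(-1 | D.natAbs) * J((W.conductorNorm ℤ : ℤ) | D.natAbs) := by
        rw [hm1, hN, hw]; ring

/-- Bookkeeping: for `r, r₁ ≤ 1` with parities read by signs `w, w₁ = ±1` (`Even r ↔ w = 1`),
`r₁ = r ↔ w₁ w = 1`. [folklore] -/
theorem rank_eq_iff_rootNumber_mul_eq_one {r r₁ : ℕ} {w w₁ : ℤ} (hr₁ : r₁ ≤ 1) (hr : r ≤ 1)
    (hp₁ : Even r₁ ↔ w₁ = 1) (hp : Even r ↔ w = 1) (hw₁ : w₁ = 1 ∨ w₁ = -1)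
    (hw : w = 1 ∨ w = -1) : r₁ = r ↔ w₁ * w = 1 := by
  rcases Nat.le_one_iff_eq_zero_or_eq_one.1 hr with rfl | rfl <;>
  rcases Nat.le_one_iff_eq_zero_or_eq_one.1 hr₁ with rfl | rfl <;>
  rcases hw with rfl | rfl <;> rcases hw₁ with rfl | rfl <;> simp_all

/-- **ROUTE B, END THEOREM: the rank dichotomy of the `a_q`-odd genus pair from ONE analytic input.**
Let `E/ℚ` be elliptic (model `W`, conductor `N`) with `r_an(E) ≤ 1`; `d ≡ D ≡ 1 (mod 4)` with `dD`
squarefree and prime to `N` (`d = M*`, `D = d_K` odd); `χ_D(−N) = J(−1 | |D|) J(N | |D|) = −1` (the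
Heegner hypothesis for `K = ℚ(√D)`, sibling file `GenusTwistSignLaw` §2); Modularity (`hmod`, `hE`) and
the parity of the analytic rank (`hpar`, Silverman AEC C.16.3; a tree theorem from Modularity,
`even_analyticRank_iff_of`). ASSUME the single analytic input `hGZ`:
`(d/ds)|_{s=1} [L(E^{(d)}, s) L(E^{(dD)}, s)] ≠ 0`, i.e. `L'(1, E, χ) ≠ 0` for the genus character `χ`
(what Cai–Shu–Tian 2014 Thm. 1.1 yields from a non-torsion genus point `P(χ)`, the output of the
genus-point combination). THEN exactly one of `E^{(d)}`, `E^{(dD)}` has analytic rank `1` and the other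
`0`, and `r_an(E^{(d)}) = r_an(E)` iff `χ_d(−N) = sign d · J(N | |d|) = 1`. Proof (route B): the pair has
root numbers `w(E^{(d)}) = sign d · J(N | |d|) · w(E)` and product `−1`, so `r₁ + r₂` is odd, `≥ 1`;
it is the order at `1` of `L(E^{(d)}, s) L(E^{(dD)}, s)`, whose derivative there is non-zero, so it is
`1`; the `iff` is parity bookkeeping. NO Heegner point, Selmer group or place-`2` condition appears.
[cite: KrizLi2019, Thm. 3.3 (arXiv) = Thm. 4.3 (FMS) (conclusion shape; there under (★), split primes)]
[cite: Darmon2004, §3.6 and Thm. 3.22] -/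
theorem analyticRank_genusPair_dichotomy (hmod : exists_isNewformOf)
    (hE : hasEntireLFunction_rat) (hpar : ∀ V : WeierstrassCurve ℚ, V.even_analyticRank_iff)
    {d D : ℤ} (hd4 : d % 4 = 1) (hD4 : D % 4 = 1) (hsq : Squarefree (d * D))
    (hgcd : Int.gcd (d * D) (W.conductorNorm ℤ) = 1)
    (hχ : J(-1 | D.natAbs) * J((W.conductorNorm ℤ : ℤ) | D.natAbs) = -1)
    (hr : W.analyticRank ≤ 1)
    (hGZ : deriv (fun s => (W.quadraticTwist (d : ℚ)).entireLFunction s *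
        (W.quadraticTwist ((d * D : ℤ) : ℚ)).entireLFunction s) 1 ≠ 0) :
    (((W.quadraticTwist (d : ℚ)).analyticRank = 1 ∧
        (W.quadraticTwist ((d * D : ℤ) : ℚ)).analyticRank = 0) ∨
      ((W.quadraticTwist (d : ℚ)).analyticRank = 0 ∧
        (W.quadraticTwist ((d * D : ℤ) : ℚ)).analyticRank = 1)) ∧
    ((W.quadraticTwist (d : ℚ)).analyticRank = W.analyticRank ↔
      Int.sign d * J((W.conductorNorm ℤ : ℤ) | d.natAbs) = 1) := by
  have hd0 : d ≠ 0 := by rintro rfl; norm_num at hd4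
  have hD0 : D ≠ 0 := by rintro rfl; norm_num at hD4
  have hdq : (d : ℚ) ≠ 0 := by exact_mod_cast hd0
  have hdDq : ((d * D : ℤ) : ℚ) ≠ 0 := by exact_mod_cast mul_ne_zero hd0 hD0
  haveI i₁ : (W.quadraticTwist (d : ℚ)).IsElliptic := W.isElliptic_quadraticTwist hdq
  haveI i₂ : (W.quadraticTwist ((d * D : ℤ) : ℚ)).IsElliptic := W.isElliptic_quadraticTwist hdDq
  set V₁ := W.quadraticTwist (d : ℚ) with hV₁
  set V₂ := W.quadraticTwist ((d * D : ℤ) : ℚ) with hV₂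
  -- root numbers: `w₁ = sign d · J(N | |d|) · w`, `w₁ w₂ = −1`
  have hsqd : Squarefree d := Squarefree.of_mul_left hsq
  have hgcdd : Int.gcd d (W.conductorNorm ℤ) = 1 :=
    Int.isCoprime_iff_gcd_eq_one.1 (Int.isCoprime_iff_gcd_eq_one.2 hgcd).of_mul_left_left
  have hw₁ : V₁.rootNumber = Int.sign d * J((W.conductorNorm ℤ : ℤ) | d.natAbs) * W.rootNumber := by
    obtain ⟨h1, -⟩ := W.rootNumber_quadraticTwist_of_emod_four_eq_one hmod hd4 hsqd hgcdd
    rw [hV₁, h1, jacobiSym_neg_one_natAbs_eq_sign' hd4]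
  have hprod : V₁.rootNumber * V₂.rootNumber = -1 := by
    rw [hV₁, hV₂, rootNumber_twist_mul_rootNumber_pairTwist W hmod hd4 hD4 hsq hgcd, hχ]
  -- order of vanishing of `L(E^{(d)}, s) L(E^{(dD)}, s)` at `1` is `r₁ + r₂`, odd, and `= 1`
  have hodd := odd_add_of_rootNumber_mul_eq_neg_one V₁ V₂ (hpar V₁) (hpar V₂) hprod
  have hord := analyticOrderNatAt_mul_entireLFunction V₁ V₂ (hE V₁) (hE V₂)
  have h1 : 1 ≤ analyticOrderNatAt (fun s => V₁.entireLFunction s * V₂.entireLFunction s) 1 := by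
    rw [hord]; exact hodd.pos
  have hsum : V₁.analyticRank + V₂.analyticRank = 1 := by
    rw [← hord]; exact (analyticOrderNatAt_eq_one_iff_deriv_ne_zero h1).2 hGZ
  refine ⟨by omega, ?_⟩
  -- which member keeps the rank of `E`: compare parities through the root numbers
  have hc : Int.sign d * J((W.conductorNorm ℤ : ℤ) | d.natAbs) = V₁.rootNumber * W.rootNumber := by
    rw [hw₁, mul_assoc]
    rcases W.rootNumber_eq_one_or with h | h <;> rw [h] <;> norm_num
  rw [hc]
  exact rank_eq_iff_rootNumber_mul_eq_one (show V₁.analyticRank ≤ 1 by omega) hr (hpar V₁) (hpar W)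
    V₁.rootNumber_eq_one_or W.rootNumber_eq_one_or

/-- **The same on models, in the literal shape of `KrizLi2019.thm33_rank_twist`'s conclusion.** For
any models `W₁ ≅ E^{(d)}`, `W₂ ≅ E^{(dD)}` (`C • Wᵢ = W.quadraticTwist _`, e.g. globally minimal ones;
`analyticRank_smul`), under the hypotheses of `analyticRank_genusPair_dichotomy` and
Gross–Zagier–Kolyvagin over `ℚ` (`hGZK`, Darmon 2004 Thm. 3.22, binder): both twists satisfy the rank
part of BSD with finite `Ш`, `{r_an(W₁), r_an(W₂)} = {0, 1}`, and `r_an(W₁) = r_an(E) ↔ sign d · J(N | |d|)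
= 1`. With `GenusTwistSignLaw.analyticRank_table_of_dichotomy` this becomes the `h_∞` table
(`r(E^{(M*)}) = r(E)` unless `Δ > 0 ∧ M* < 0`).
[cite: KrizLi2019, Thm. 3.3 (arXiv) = Thm. 4.3 (FMS) (conclusion shape)] [cite: Darmon2004, Thm. 3.22] -/
theorem rank_genusPair_dichotomy_of_models (hmod : exists_isNewformOf)
    (hE : hasEntireLFunction_rat) (hpar : ∀ V : WeierstrassCurve ℚ, V.even_analyticRank_iff)
    (hGZK : rank_eq_analyticRank_of_analyticRank_le_one)
    {d D : ℤ} (hd4 : d % 4 = 1) (hD4 : D % 4 = 1) (hsq : Squarefree (d * D))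
    (hgcd : Int.gcd (d * D) (W.conductorNorm ℤ) = 1)
    (hχ : J(-1 | D.natAbs) * J((W.conductorNorm ℤ : ℤ) | D.natAbs) = -1)
    (hr : W.analyticRank ≤ 1)
    (hGZ : deriv (fun s => (W.quadraticTwist (d : ℚ)).entireLFunction s *
        (W.quadraticTwist ((d * D : ℤ) : ℚ)).entireLFunction s) 1 ≠ 0)
    (W₁ W₂ : WeierstrassCurve ℚ) [W₁.IsElliptic] [W₂.IsElliptic]
    (h₁ : ∃ C : VariableChange ℚ, C • W₁ = W.quadraticTwist (d : ℚ))
    (h₂ : ∃ C : VariableChange ℚ, C • W₂ = W.quadraticTwist ((d * D : ℤ) : ℚ)) :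
    W₁.mordellWeilRank = W₁.analyticRank ∧ W₂.mordellWeilRank = W₂.analyticRank ∧
      Finite W₁.sha ∧ Finite W₂.sha ∧
      ((W₁.analyticRank = 1 ∧ W₂.analyticRank = 0) ∨ (W₁.analyticRank = 0 ∧ W₂.analyticRank = 1)) ∧
      (W₁.analyticRank = W.analyticRank ↔
        Int.sign d * J((W.conductorNorm ℤ : ℤ) | d.natAbs) = 1) := by
  obtain ⟨C₁, hC₁⟩ := h₁
  obtain ⟨C₂, hC₂⟩ := h₂
  have e₁ : W₁.analyticRank = (W.quadraticTwist (d : ℚ)).analyticRank := by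
    rw [← hC₁]; exact (W₁.analyticRank_smul C₁).symm
  have e₂ : W₂.analyticRank = (W.quadraticTwist ((d * D : ℤ) : ℚ)).analyticRank := by
    rw [← hC₂]; exact (W₂.analyticRank_smul C₂).symm
  obtain ⟨hdich, hiff⟩ :=
    analyticRank_genusPair_dichotomy W hmod hE hpar hd4 hD4 hsq hgcd hχ hr hGZ
  rw [← e₁, ← e₂] at hdich
  rw [← e₁] at hiff
  have hr₁ : W₁.analyticRank ≤ 1 := by omega
  have hr₂ : W₂.analyticRank ≤ 1 := by omega
  obtain ⟨hm₁, hf₁⟩ := hGZK W₁ hr₁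
  obtain ⟨hm₂, hf₂⟩ := hGZK W₂ hr₂
  exact ⟨hm₁, hm₂, hf₁, hf₂, hdich, hiff⟩

end Summit.BirchSwinnertonDyer.Uniform.U2

end
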